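import Literature.Probability.LatticeModels.FlipReflectionDomination
import Literature.Probability.LatticeModels.PlusMinusReflectionInvariance
import Literature.Probability.LatticeModels.EnclosureCriterion
import Literature.Probability.Percolation.CerfTwoArmsProofs
import HarnessLib

/-!
# Folding a bad cluster into a half-space (Georgii–Higuchi 2000, Lemma 3.1, Step 1)

Topic `Probability/LatticeModels`; theorems only. In Step 1 of the proof of the butterfly lemma
(Lemma 3.1, p. 7) Georgii–Higuchi deduce the hypothesis of the flip-reflection domination
(Lemma 2.2) from the absence of infinite `-`clusters in a half-plane: "`μ(E⁻_π) = 0` … means that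
for `μ`-almost all `ω` every finite `Δ ⊂ π` is surrounded by some `+∗`semicircuit `γ` in `π`. For
such a `γ`, `c = γ ∪ R(γ)` is an `R`-invariant `∗`circuit … and satisfies `ω ≥ R∘T(ω)` on `c`."
In the circuit-free language of `FlipReflectionDomination`/`EnclosureCriterion` the required
input is: *almost surely no cluster of bad sites `{ω = ω∘R = -1}` is infinite*. This file proves
the deterministic core for the reflection `R = reflectCoord i` of `ℤ^d` in a coordinate
hyperplane (any `d`):

* `foldCoord i` — `x ↦ x` if `x_i ≥ 0`, `x ↦ R x` otherwise; it maps adjacent bad sites to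
  adjacent `-` sites of the closed half-space `{x_i ≥ 0}` (`zdGraph_adj_foldCoord`), so an
  infinite bad cluster folds onto an infinite `-`cluster inside the half-space
  (**`infinite_siteCluster_halfSpace_of_infinite_badCluster`**);
* `measure_badSites_percolates_eq_zero_of_upper` / `_of_lower` — hence if `μ`-a.s. there is no
  infinite `-`cluster in `{x_i ≥ 0}` (resp. in `{x_i ≤ 0}`), then `μ`-a.s. no bad cluster is
  infinite, which is the hypothesis of `tendsto_measure_not_subset_explVolume_of`.

## References

* H.-O. Georgii, Y. Higuchi, J. Math. Phys. 41 (2000) 1153–1169, proof of Lemma 3.1, Step 1,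
  p. 7 [GeorgiiHiguchi2000].
-/

noncomputable section

open MeasureTheory
open Literature.Probability.Percolation

namespace Literature.Probability.LatticeModels

variable {d : ℕ}

/-! ### Half-spaces and the folding map -/

/-- The closed upper half-space `{x | 0 ≤ x_i}` of `ℤ^d` (for `d = 2`, `i = 1`: Georgii–Higuchi's
`π_up`). [cite: GeorgiiHiguchi2000, §2 p. 3] -/
def upperHalfSpace (i : Fin d) : Set (Site d) := {x | 0 ≤ x i}

/-- The closed lower half-space `{x | x_i ≤ 0}` (`π_down`). [cite: GeorgiiHiguchi2000, §2 p. 3] -/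
def lowerHalfSpace (i : Fin d) : Set (Site d) := {x | x i ≤ 0}

/-- The **folding map** into the upper half-space: the identity there, the reflection
`reflectCoord i` elsewhere (Georgii–Higuchi 2000, proof of Lemma 3.1: "`c = γ ∪ R(γ)`" read
backwards). [cite: GeorgiiHiguchi2000, Lemma 3.1 (proof, Step 1, p. 7)] -/
def foldCoord (i : Fin d) (x : Site d) : Site d := if 0 ≤ x i then x else reflectCoord i x

/-- The folded site lies in the upper half-space. [cite: GeorgiiHiguchi2000, Lemma 3.1 (proof, Step 1, p. 7)] -/
theorem foldCoord_mem_upperHalfSpace (i : Fin d) (x : Site d) : foldCoord i x ∈ upperHalfSpace i := by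
  unfold foldCoord upperHalfSpace
  by_cases hx : 0 ≤ x i
  · simp [hx]
  · rw [if_neg hx, Set.mem_setOf_eq, reflectCoord_apply, if_pos rfl]
    omega

/-- The fibres of the folding map have at most two points. [cite: GeorgiiHiguchi2000, Lemma 3.1 (proof, Step 1, p. 7)] -/
theorem foldCoord_preimage_singleton_subset (i : Fin d) (z : Site d) :
    foldCoord i ⁻¹' {z} ⊆ {z, reflectCoord i z} := by
  intro x hx
  simp only [Set.mem_preimage, Set.mem_singleton_iff, foldCoord] at hx
  by_cases h : 0 ≤ x i
  · rw [if_pos h] at hx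
    exact Or.inl hx
  · rw [if_neg h] at hx
    right
    rw [Set.mem_singleton_iff, ← hx, reflectCoord_reflectCoord]

/-- A bad site folds onto a `-` site of the upper half-space. [cite: GeorgiiHiguchi2000, Lemma 3.1 (proof, Step 1, p. 7)] -/
theorem foldCoord_mem_of_mem_badSites (i : Fin d) {ω : SpinConfig (Site d)} {x : Site d}
    (hx : x ∈ badSites (reflectCoord i).toEquiv ω) :
    foldCoord i x ∈ spinSites (-1) ω ∩ upperHalfSpace i := by
  refine ⟨?_, foldCoord_mem_upperHalfSpace i x⟩
  rw [mem_badSites] at hx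
  unfold foldCoord
  by_cases h : 0 ≤ x i
  · rw [if_pos h]; exact hx.1
  · rw [if_neg h]; exact hx.2

/-- **Folding preserves adjacency of bad sites**: two adjacent bad sites fold onto adjacent sites
(if they lie on different sides of the hyperplane, they are `x` with `x_i = 0` and `x - e_i`, and
`R(x - e_i) = x + e_i ∼ x`). [cite: GeorgiiHiguchi2000, Lemma 3.1 (proof, Step 1, p. 7)] -/
theorem zdGraph_adj_foldCoord (i : Fin d) {a b : Site d} (hab : (zdGraph d).Adj a b) :
    (zdGraph d).Adj (foldCoord i a) (foldCoord i b) := by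
  have hR : ∀ {x y : Site d}, (zdGraph d).Adj x y → (zdGraph d).Adj (reflectCoord i x) (reflectCoord i y) :=
    fun h => ((reflectCoord i).map_adj_iff).2 h
  -- coordinates of adjacent sites differ by at most one in the `i`-th coordinate
  have hcoord : b i = a i + 1 ∧ (∀ k, k ≠ i → b k = a k) ∨ a i = b i + 1 ∧ (∀ k, k ≠ i → b k = a k) ∨
      b i = a i := by
    obtain ⟨j, h | h⟩ := (zdGraph_adj_iff a b).1 hab
    · by_cases hji : j = i
      · subst hji
        left
        refine ⟨by rw [h]; simp, fun k hk => by rw [h]; simp [Pi.single_eq_of_ne hk]⟩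
      · right; right; rw [h]; simp [Pi.single_eq_of_ne (Ne.symm hji)]
    · by_cases hji : j = i
      · subst hji
        right; left
        refine ⟨by rw [h]; simp, fun k hk => by rw [h]; simp [Pi.single_eq_of_ne hk]⟩
      · right; right; rw [h]; simp [Pi.single_eq_of_ne (Ne.symm hji)]
  unfold foldCoord
  by_cases ha : 0 ≤ a i <;> by_cases hb : 0 ≤ b i
  · rw [if_pos ha, if_pos hb]; exact hab
  · -- `a_i = 0`, `b = a - e_i`, `R b = a + e_i`
    rw [if_pos ha, if_neg hb]
    rcases hcoord with ⟨h1, -⟩ | ⟨h1, h2⟩ | h1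
    · omega
    · have hai : a i = 0 := by omega
      have hRb : reflectCoord i b = a + Pi.single i 1 := by
        funext k
        rw [reflectCoord_apply]
        by_cases hk : k = i
        · subst hk; simp; omega
        · simp [hk, h2 k hk]
      rw [hRb]
      exact (zdGraph_adj_iff _ _).2 ⟨i, Or.inl rfl⟩
    · omega
  · rw [if_neg ha, if_pos hb]
    rcases hcoord with ⟨h1, h2⟩ | ⟨h1, -⟩ | h1
    · have hbi : b i = 0 := by omega
      have hRa : reflectCoord i a = b + Pi.single i 1 := by
        funext k
        rw [reflectCoord_apply]
        by_cases hk : k = i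
        · subst hk; simp; omega
        · simp [hk, h2 k hk]
      rw [hRa]
      exact (zdGraph_adj_iff _ _).2 ⟨i, Or.inr rfl⟩
    · omega
    · omega
  · rw [if_neg ha, if_neg hb]; exact hR hab

/-- The folding map as a homomorphism from the graph of bad sites to the graph of `-` sites of the
upper half-space. [cite: GeorgiiHiguchi2000, Lemma 3.1 (proof, Step 1, p. 7)] -/
def foldHom (i : Fin d) (ω : SpinConfig (Site d)) :
    siteOpenGraph (zdGraph d) (badSites (reflectCoord i).toEquiv ω) →g
      siteOpenGraph (zdGraph d) (spinSites (-1) ω ∩ upperHalfSpace i) where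
  toFun := foldCoord i
  map_rel' := by
    intro a b hab
    rw [siteOpenGraph_adj] at hab ⊢
    exact ⟨zdGraph_adj_foldCoord i hab.1, foldCoord_mem_of_mem_badSites i hab.2.1,
      foldCoord_mem_of_mem_badSites i hab.2.2⟩

/-! ### An infinite bad cluster folds onto an infinite `-`cluster in the half-space -/

/-- **An infinite cluster of bad sites forces an infinite `-`cluster inside the upper half-space**
(Georgii–Higuchi 2000, proof of Lemma 3.1, Step 1: absence of `-`percolation in `π` gives the
enclosing circuits on which `ω ≥ R∘T(ω)`; contrapositive, circuit-free form): the folding map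
sends the bad cluster of `t` into the `-`cluster of `foldCoord i t` for the open set
`S⁻(ω) ∩ {x_i ≥ 0}`, and is at most two-to-one. [cite: GeorgiiHiguchi2000, Lemma 3.1 (proof, Step 1, p. 7)] -/
theorem infinite_siteCluster_halfSpace_of_infinite_badCluster (i : Fin d) (ω : SpinConfig (Site d))
    {t : Site d} (ht : (siteCluster (zdGraph d) (badSites (reflectCoord i).toEquiv ω) t).Infinite) :
    (siteCluster (zdGraph d) (spinSites (-1) ω ∩ upperHalfSpace i) (foldCoord i t)).Infinite := by
  set C := siteCluster (zdGraph d) (badSites (reflectCoord i).toEquiv ω) t with hC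
  have htbad : t ∈ badSites (reflectCoord i).toEquiv ω := by
    obtain ⟨y, hy⟩ := ht.nonempty
    exact hy.1
  -- the image of `C` lies in the `-`cluster of `foldCoord i t`
  have himage : foldCoord i '' C ⊆
      siteCluster (zdGraph d) (spinSites (-1) ω ∩ upperHalfSpace i) (foldCoord i t) := by
    rintro _ ⟨y, ⟨-, hybad, hreach⟩, rfl⟩
    exact ⟨foldCoord_mem_of_mem_badSites i htbad, foldCoord_mem_of_mem_badSites i hybad,
      hreach.map (foldHom i ω)⟩
  refine Set.Infinite.mono himage ?_
  -- the image is infinite since the fibres are finite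
  intro hfin
  apply ht
  refine (hfin.preimage' fun z _ => ?_).subset (Set.subset_preimage_image _ _)
  exact (Set.toFinite ({z, reflectCoord i z} : Set (Site d))).subset
    (foldCoord_preimage_singleton_subset i z)

/-- **No `-`percolation in the upper half-space ⇒ no bad percolation, almost surely** (the input of
`EnclosureCriterion.tendsto_measure_not_subset_explVolume_of` for the bad sites). [cite: GeorgiiHiguchi2000, Lemma 3.1 (proof, Step 1, p. 7)] -/
theorem measure_badSites_percolates_eq_zero_of_upper (i : Fin d) (μ : Measure (SpinConfig (Site d)))
    (hπ : μ {ω | ∃ x, (siteCluster (zdGraph d) (spinSites (-1) ω ∩ upperHalfSpace i) x).Infinite} = 0)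
    (t : Site d) :
    μ {ω | badSites (reflectCoord i).toEquiv ω ∈ sitePercolatesAt (zdGraph d) t} = 0 := by
  refine measure_mono_null (fun ω hω => ?_) hπ
  exact ⟨_, infinite_siteCluster_halfSpace_of_infinite_badCluster i ω hω⟩

/-! ### The lower half-space, by reflection -/

/-- Relabelling by the coordinate reflection exchanges the half-spaces on the `-` sites:
`S⁻(R_R ω) ∩ {x_i ≥ 0} = R(S⁻(ω) ∩ {x_i ≤ 0})`. [cite: GeorgiiHiguchi2000, §2 p. 3] -/
theorem spinSites_configRelabel_inter_upper (i : Fin d) (s : ℤˣ) (ω : SpinConfig (Site d)) :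
    spinSites s (configRelabel (reflectCoord i).toEquiv ω) ∩ upperHalfSpace i =
      (reflectCoord i) '' (spinSites s ω ∩ lowerHalfSpace i) := by
  ext z
  simp only [Set.mem_inter_iff, mem_spinSites, configRelabel_apply, Set.mem_image, upperHalfSpace,
    lowerHalfSpace, Set.mem_setOf_eq]
  have hsymm : (reflectCoord i).toEquiv.symm z = reflectCoord i z := by
    rw [Equiv.symm_apply_eq]; exact (reflectCoord_reflectCoord i z).symm
  constructor
  · rintro ⟨hz, hzi⟩
    refine ⟨reflectCoord i z, ⟨by rwa [hsymm] at hz, ?_⟩, reflectCoord_reflectCoord i z⟩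
    rw [reflectCoord_apply, if_pos rfl]; omega
  · rintro ⟨y, ⟨hy, hyi⟩, rfl⟩
    refine ⟨?_, ?_⟩
    · rw [hsymm, reflectCoord_reflectCoord]; exact hy
    · rw [reflectCoord_apply, if_pos rfl]; omega

/-- The bad sites are unchanged by relabelling with the (involutive) reflection. [cite: GeorgiiHiguchi2000, Lemma 2.2 (p. 5)] -/
theorem badSites_configRelabel (i : Fin d) (ω : SpinConfig (Site d)) :
    badSites (reflectCoord i).toEquiv (configRelabel (reflectCoord i).toEquiv ω) =
      badSites (reflectCoord i).toEquiv ω := by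
  ext z
  have hsymm : ∀ x, (reflectCoord i).toEquiv.symm x = reflectCoord i x := fun x => by
    rw [Equiv.symm_apply_eq]; exact (reflectCoord_reflectCoord i x).symm
  simp only [mem_badSites, configRelabel_apply, hsymm]
  change ω (reflectCoord i z) = -1 ∧ ω (reflectCoord i (reflectCoord i z)) = -1 ↔ _
  rw [reflectCoord_reflectCoord]
  exact and_comm

/-- **No `-`percolation in the lower half-space ⇒ no bad percolation, almost surely** (reflect
and use the upper half-space statement). [cite: GeorgiiHiguchi2000, Lemma 3.1 (proof, Step 1, p. 7)] -/
theorem measure_badSites_percolates_eq_zero_of_lower (i : Fin d) (μ : Measure (SpinConfig (Site d)))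
    (hπ : μ {ω | ∃ x, (siteCluster (zdGraph d) (spinSites (-1) ω ∩ lowerHalfSpace i) x).Infinite} = 0)
    (t : Site d) :
    μ {ω | badSites (reflectCoord i).toEquiv ω ∈ sitePercolatesAt (zdGraph d) t} = 0 := by
  refine measure_mono_null (fun ω hω => ?_) hπ
  -- fold the bad cluster of the reflected configuration
  set ω' := configRelabel (reflectCoord i).toEquiv ω with hω'
  have hω'bad : (siteCluster (zdGraph d) (badSites (reflectCoord i).toEquiv ω') t).Infinite := by
    rwa [hω', badSites_configRelabel]
  have hinf := infinite_siteCluster_halfSpace_of_infinite_badCluster i ω' hω'bad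
  rw [hω', spinSites_configRelabel_inter_upper] at hinf
  -- `foldCoord i t = R y` for `y := R (foldCoord i t)`; transport the cluster back by `R`
  set y := reflectCoord i (foldCoord i t) with hy
  have hRy : reflectCoord i y = foldCoord i t := reflectCoord_reflectCoord i _
  rw [← hRy] at hinf
  have key := siteCluster_relabel (reflectCoord i) (spinSites (-1) ω ∩ lowerHalfSpace i) y
  rw [SiteConfig.relabel_apply] at key
  change siteCluster (zdGraph d) ((reflectCoord i) '' (spinSites (-1) ω ∩ lowerHalfSpace i))
      (reflectCoord i y) = (reflectCoord i) '' siteCluster (zdGraph d)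
        (spinSites (-1) ω ∩ lowerHalfSpace i) y at key
  rw [key] at hinf
  exact ⟨y, Set.Infinite.of_image _ hinf⟩

end Literature.Probability.LatticeModels
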